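import Summits.CriticalPhenomena.SAWScalingLimit.Theses.SAWBetheAnsatz
import Summits.CriticalPhenomena.SAWScalingLimit.Theorems.SAWDevelopingMapHexTightOnFrontierFar
import HarnessLib

/-!
# Birth skeleton — crux `HexEventualTight` (stmt-CriticalPhenomena-4997), route `SAWBetheAnsatz`

Crux (FIXED, concluded BY NAME by `HexEventualTight_of`; rank 4 of
`route-CriticalPhenomena-SAWBetheAnsatz`, the precompactness input of its Prokhorov assembly `closes`;
support item of `SAWLatticeVirasoro` / `SAWTurnDefect`):

  `∀ D a b, SAW.IsEmbEndpointApprox hexGraph hexCenter D a b →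
      ∃ δ₀ > 0, IsTightMeasureSet ((fun δ ↦ (hexSAWLaw D.carrier δ (a δ) (b δ)).map (·.curve)) '' Ioc 0 δ₀)`

— tightness, on `CurveClass ℂ`, of the critical hexagonal SAW laws on an initial mesh interval
(the `∃ δ₀` SET form; the along-the-mesh twin `IsTightAlongMesh` is the crux `HexTight`,
stmt-CriticalPhenomena-5423, of six sibling routes).

## The cut (two registered stubs): Aizenman–Burchard per-shell tightness, INTERIOR / ON-FRONTIER-FAR

The standing analysis of hexagonal SAW tightness (`Cruxes/HexTight/STRATEGY-CENSUS.md` §0, §Decomposition D1;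
`Cruxes/HexTight/Disproof.lean` §4, §6) shows that the Aizenman–Burchard framing is EXACT: tightness of the laws
is equivalent to per-shell, RATE-FREE tightness of the NUMBER of separate traversals of thin shells `D(x; ρ, R)`,
`4ρ < R ≤ 1`, by the SAW polyline, and only two kinds of shells matter —

* `stub_interiorThinPerShellTight` — **INTERIOR SHELLS** (`closedBall x R ⊆ Ω`): for every `η > 0` some threshold
  `k` and mesh threshold `δ₁` with `P_δ[k separate traversals of D(x; ρ, R)] ≤ η` for `δ ∈ (0, δ₁]`, `δ ≤ ρ`
  (bulk multi-arm regularity of the two-pinned critical SAW; landed lattice-sufficient form: `PinchDecay`,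
  `Reversal.interiorThinPerShellTight_of_pinchDecay`, p118066);
* `stub_onFrontierFarPerShellTight` — **SHELLS CENTRED ON THE JORDAN CURVE, FAR FROM THE MARKED POINTS**
  (`x ∈ frontier Ω`, `R < dist x (D.pt i)`): the same (boundary multi-arm regularity; the only place the
  Jordan loop of `D` enters, and the endpoints force no traversal there).

Both are verbatim the atoms `InteriorThinPerShellTight` / `OnFrontierFarPerShellTight` of the twin crux's
registered skeleton `Cruxes/HexTight/Lines/reversal_virgin_disc.lean` (r9) — ONE pair of research-open a-priori
estimates serves both filings of this crux.

## Composition (PROVED here, no `sorry`): `HexEventualTight_of`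

interior + on-frontier-far ⇒ (landed dodge `BoundaryOnFrontier.onFrontier_of_interiorThin_of_onFrontierFar`,
p118802) the full on-frontier atom ⇒ (landed `BoundaryOnFrontier.traversalBound_of_interiorThin_of_onFrontier`,
shell chaining with `K = 64³`, `λ = 3`) Aizenman–Burchard's hypothesis (H1) for the hexagonal SAW law per
`(D, a, b)` ⇒ (`isTightMeasureSet_image_of_traversalBound`, THIS FILE: the tree's proved AB criterion
`isTightMeasureSet_of_traversalBounds`, AB99 Thms 1.1–1.2, with container `B̄(0, r_Λ)`, `d = 2`, random
curves `hexPolyline`, index set `T = (0, δ₁]`, threshold `max 487 k`, (H0) = confinement + the landed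
short-distance cutoff `not_hasTraversals_hexPolyline`) the SET-form tightness on `(0, δ₁]` — i.e. the
crux BY NAME, WITHOUT the detour through `IsTightAlongMesh` (the `∃ δ₀` form is the native output shape
of the AB criterion; cf. `Disproof.lean` §4 `hexEventualTight_iff_crux`).

## Calibration against `Cruxes/HexTight/Disproof.lean` (cdisprove gens 1–3, attached to this item) and
`Theorems/HexTight/Negative/*`

* §2 `hexTight_false_without_endpointLimits`: HONOURED — the endpoint limit `IsEmbEndpointApprox.tendsto_fst`
  is SPENT in `isTightMeasureSet_image_of_traversalBound` (the head `δ·c_{a δ}` lies in `B(a, 1)` below `δ₂`,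
  which confines the trivial walk `a δ = b δ`); both stubs keep `IsEmbEndpointApprox` as a hypothesis.
* §3e `not_hexTightAllMeshes` (hex twin of stmt-0772) / `not_hexTightUniformThreshold` / `not_hexTightFiniteNet`:
  every threshold here (`k, δ₁` per shell and per `η`; `δ₁` of the conclusion per `(D, a, b)`) depends on the
  approximation; the compact sets are AB's genuine continua; nothing is asked for all `δ ∈ (0, 1]`.
* §7 ring/corridor barrier (`Negative.not_latticeG2AsTyped`, `not_outwardDiveBoundAsTyped`,
  `not_pinnedReturnBoundAsTyped`): not in its class — both stubs are ANNEALED (unconditional law bounds,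
  no past-conditioning, no constant-form G2) — `Disproof.lean` §7 lists the annealed AB rung as NOT affected.
* `Negative/OneScaleDive{Arcs,Chains}` (subcritical dives): constrains PROOFS of the interior stub (they must
  consume criticality), not its statement. No landed `Negative/*` lemma has an instance among the two stubs;
  negatives index: only stmt-0772 concerns tightness (avoided as above).

## Audit record (planner skeleton-register, 2026-08-17)

* `lean check --json`: rc 0, errors [], `sorries = 2` = the two `stub_*` (no other `sorry`);
  `#print axioms HexEventualTight_of` = `[propext, Classical.choice, Quot.sound]`;
  `isTightMeasureSet_image_of_traversalBound` and `traversalBound_of_atoms` closed (sorry-free).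
* `#h21_check_skeleton "stmt-CriticalPhenomena-4997" …SAWBetheAnsatz.HexEventualTight stub_interiorThinPerShellTight
  stub_onFrontierFarPerShellTight`: `ok = true`, `codes = []`, theorem `HexEventualTight_of`, both stubs resolved to the
  sorried theorems (signatures `InteriorThinPerShellTight` / `OnFrontierFarPerShellTight`).
* BC3 probes (planner folder `bc/dprobe_*.lean`: environment = `…SAWScalingLimit.Statement` + the route file + the two
  definitions only; battery `first | exact? | simpa | simpa [S] | (unfold S; simpa) | aesop` ⊇ `first | exact? | simpa | aesop`,
  each pair plain AND with the hypothesis introduced): `InteriorThinPerShellTight → HexEventualTight` FAIL ×2,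
  `InteriorThinPerShellTight → SAWScalingLimit` FAIL ×2, `OnFrontierFarPerShellTight → HexEventualTight` FAIL ×2,
  `OnFrontierFarPerShellTight → SAWScalingLimit` FAIL ×2 ("unsolved goals" after exhaustive `aesop`; `exact?`/`simpa`
  find nothing); the same eight probes with this whole file in scope (`bc/sprobe_*.lean`: sorried stubs, composition and
  every landed `HexTight` theorem imported) FAIL ×8 too. Converse probes (crux → stub, Statement → stub; recorded, not
  required) FAIL ×4 in the definitions-only environment (in the full environment they are closed vacuously by the sorried
  stub itself, `exact stub_…`) — although the crux does imply each stub through the landed chain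
  (`isTightAlongMesh_of_isTightMeasureSet_image` + `BoundaryOnFrontier.perShellTight_of_hexTight`: consequences used toward
  the crux). No stub is cheaply the crux or the summit.

Namespace `…Cruxes.HexEventualTight.Birth`.
-/

noncomputable section

open scoped BigOperators Classical ENNReal NNReal
open MeasureTheory Filter Topology Set Metric
open Literature.Probability.LatticeModels Literature.Probability.RandomPlanarGeometry
  Literature.Probability.RandomPlanarGeometry.SAW
open Summit.CriticalPhenomena.SAWScalingLimit.Theorems.HexTight.BoundaryOnFrontier
  (onFrontier_of_interiorThin_of_onFrontierFar traversalBound_of_interiorThin_of_onFrontier)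
open Summit.CriticalPhenomena.SAWScalingLimit.Theorems.HexConjecture.MarginalWedge
  (hexPolyline mk_hexPolyline)
open Summit.CriticalPhenomena.SAWScalingLimit.Theorems.HexConjecture.MarginalWedge.Tight
  (not_hasTraversals_hexPolyline)
open Summit.CriticalPhenomena.SAWScalingLimit.Theorems.ObservableToSLE.Negative
  (mem_embMeshDomain_of_mem_support_tail)
open Summit.CriticalPhenomena.SAWScalingLimit.Theorems (range_toCurve_subset_of_convex)

namespace Summit.CriticalPhenomena.SAWScalingLimit.Cruxes.HexEventualTight.Birth

/-! ### Stub statements (verbatim the r9 atoms of `Cruxes/HexTight/Lines/reversal_virgin_disc.lean`) -/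

/-- **STUB 1 statement — `InteriorThinPerShellTight`**: per-shell rate-free tightness of the number of separate
traversals of thin INTERIOR shells `D(x; ρ, R)`, `4ρ < R ≤ 1`, `closedBall x R ⊆ Ω`, by the critical hexagonal
SAW polyline: for every `η > 0` a threshold `k` and a mesh threshold `δ₁` with
`P_δ[k separate traversals] ≤ η` for `δ ∈ (0, δ₁]`, `δ ≤ ρ`. -/
def InteriorThinPerShellTight : Prop :=
  ∀ (D : DobrushinDomain) (a b : ℝ → HexVertex), IsEmbEndpointApprox hexGraph hexCenter D a b →
    ∀ (x : ℂ) (ρ R : ℝ), 0 < ρ → 4 * ρ < R → R ≤ 1 → Metric.closedBall x R ⊆ D.carrier → ∀ η : ℝ, 0 < η →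
      ∃ (k : ℕ) (δ₁ : ℝ), 0 < δ₁ ∧ ∀ δ ∈ Set.Ioc (0 : ℝ) δ₁, δ ≤ ρ →
        hexSAWLaw D.carrier δ (a δ) (b δ)
          {γ | (⟨γ.walk.toCurve fun v => (δ : ℂ) * hexCenter v⟩ : Curve ℂ).HasTraversals k x ρ R} ≤
          ENNReal.ofReal η

/-- **STUB 2 statement — `OnFrontierFarPerShellTight`**: the same on thin shells centred at a point `x` of the
Jordan curve `frontier Ω` whose closed outer disc contains NEITHER marked point (`R < dist x (D.pt i)`), i.e.
on the boundary shells where the endpoints force no traversal. -/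
def OnFrontierFarPerShellTight : Prop :=
  ∀ (D : DobrushinDomain) (a b : ℝ → HexVertex), IsEmbEndpointApprox hexGraph hexCenter D a b →
    ∀ (x : ℂ) (ρ R : ℝ), 0 < ρ → 4 * ρ < R → R ≤ 1 → x ∈ frontier D.carrier →
      R < dist x (D.pt 0) → R < dist x (D.pt 1) → ∀ η : ℝ, 0 < η →
      ∃ (k : ℕ) (δ₁ : ℝ), 0 < δ₁ ∧ ∀ δ ∈ Set.Ioc (0 : ℝ) δ₁, δ ≤ ρ →
        hexSAWLaw D.carrier δ (a δ) (b δ)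
          {γ | (⟨γ.walk.toCurve fun v => (δ : ℂ) * hexCenter v⟩ : Curve ℂ).HasTraversals k x ρ R} ≤
          ENNReal.ofReal η

/-! ### The registered stubs (the ONLY `sorry`s of the file) -/

/-- STUB 1 (open; bulk multi-arm regularity of the two-pinned critical hexagonal SAW; landed lattice-sufficient
form `PinchDecay`): per-shell tightness of the traversal number on thin interior shells. -/
theorem stub_interiorThinPerShellTight : InteriorThinPerShellTight := by
  sorry

/-- STUB 2 (open; boundary multi-arm regularity at the Jordan curve, far from the marked points): per-shell
tightness of the traversal number on thin frontier-centred shells missing both marked points. -/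
theorem stub_onFrontierFarPerShellTight : OnFrontierFarPerShellTight := by
  sorry

/-! ### Name-keyed aliases — the hypotheses of `HexEventualTight_of`

The native skeleton audit (`#h21_check_skeleton`) admits a `Prop` hypothesis of the skeleton theorem only if its
head constant is a registered obligation or is NAMED like a declared stub; `__Registered.stub_X` is the statement of
`stub_X` under that name (device of `Cruxes/EventualTight/Lines/birth.lean`). Each alias is `rfl`-equal to its
statement. -/
namespace __Registered

/-- Alias of `InteriorThinPerShellTight` keyed by the registered stub name. -/
abbrev stub_interiorThinPerShellTight : Prop := InteriorThinPerShellTight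
/-- Alias of `OnFrontierFarPerShellTight` keyed by the registered stub name. -/
abbrev stub_onFrontierFarPerShellTight : Prop := OnFrontierFarPerShellTight

end __Registered

/-! ### Glue (PROVED): Aizenman–Burchard (H1) per `(D, a, b)`, and the criterion in SET form -/

/-- **(H1) for the hexagonal SAW law from the two atoms** (all landed: the dodge
`onFrontier_of_interiorThin_of_onFrontierFar` at `p₀ = D.pt 0`, `p₁ = D.pt 1`, then shell chaining
`traversalBound_of_interiorThin_of_onFrontier`, `K = 64³`, `λ = 3`, `δ₀ = 1`). [folklore] -/
theorem traversalBound_of_atoms (hI : InteriorThinPerShellTight) (hF : OnFrontierFarPerShellTight)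
    (D : DobrushinDomain) (a b : ℝ → HexVertex) (hab : IsEmbEndpointApprox hexGraph hexCenter D a b) :
    ∃ (k : ℂ → ℝ → ℝ → ℕ) (K lam δ₀ : ℝ), 0 ≤ K ∧ 2 < lam ∧ 0 < δ₀ ∧
      ∀ δ ∈ Set.Ioc (0 : ℝ) δ₀, ∀ (x : ℂ) (ρ R : ℝ), δ ≤ ρ → ρ < R → R ≤ 1 →
        hexSAWLaw D.carrier δ (a δ) (b δ) {γ | (hexPolyline γ).HasTraversals (k x ρ R) x ρ R} ≤
          ENNReal.ofReal (K * (ρ / R) ^ lam) :=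
  traversalBound_of_interiorThin_of_onFrontier D.isOpen (hI D a b hab)
    (onFrontier_of_interiorThin_of_onFrontierFar (D.pt 0) (D.pt 1) D.carrier D.isOpen a b (hI D a b hab)
      (hF D a b hab))

/-- **Aizenman–Burchard in SET form for the hexagonal SAW law.** A multi-traversal bound (H1) with exponent
`λ > 2` for `δ ∈ (0, δ₀]` gives a mesh threshold `δ₁ > 0` such that the push-forward laws on `CurveClass ℂ`,
`δ ∈ (0, δ₁]`, form a tight set — the tree's proved criterion `isTightMeasureSet_of_traversalBounds`
(container `B̄(0, r_Λ)` holding `D` and `B(D.pt 0, 1)`, covering exponent `d = 2`, curves `hexPolyline`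
(class `γ.curve`, `mk_hexPolyline`), `T = (0, δ₁]` with `δ₁ = min (min δ₀ (δ₂/2)) 1`, where the head
`δ·c_{a δ} ∈ B(D.pt 0, 1)` for `0 < δ < δ₂` by the endpoint limit; threshold `max 487 k`; (H0) =
`range_toCurve_subset_of_convex` + `not_hasTraversals_hexPolyline`). Declaration by declaration the proof of
`HexConjecture.MarginalWedge.stub_hexTight_of_traversalBound` minus its last bridge to `IsTightAlongMesh`.
[cite: AizenmanBurchardDuke1999, Thms 1.1-1.2 and §1.a] -/
theorem isTightMeasureSet_image_of_traversalBound {D : DobrushinDomain} {a b : ℝ → HexVertex}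
    (hab : IsEmbEndpointApprox hexGraph hexCenter D a b)
    (hTB : ∃ (k : ℂ → ℝ → ℝ → ℕ) (K lam δ₀ : ℝ), 0 ≤ K ∧ 2 < lam ∧ 0 < δ₀ ∧
      ∀ δ ∈ Set.Ioc (0 : ℝ) δ₀, ∀ (x : ℂ) (ρ R : ℝ), δ ≤ ρ → ρ < R → R ≤ 1 →
        hexSAWLaw D.carrier δ (a δ) (b δ) {γ | (hexPolyline γ).HasTraversals (k x ρ R) x ρ R} ≤
          ENNReal.ofReal (K * (ρ / R) ^ lam)) :
    ∃ δ₁ : ℝ, 0 < δ₁ ∧ IsTightMeasureSet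
      ((fun δ : ℝ => (hexSAWLaw D.carrier δ (a δ) (b δ)).map (fun γ => γ.curve)) '' Set.Ioc 0 δ₁) := by
  obtain ⟨k, K, lam, δ₀, hK, hlam, hδ₀, hbound⟩ := hTB
  -- the head `δ c_{a δ}` is within `1` of the marked point `a` for small `δ` (endpoint limit, spent HERE)
  have hnear : ∀ᶠ δ : ℝ in 𝓝[>] (0 : ℝ), (δ : ℂ) * hexCenter (a δ) ∈ ball (D.pt 0) 1 :=
    hab.tendsto_fst.eventually_mem (ball_mem_nhds _ one_pos)
  obtain ⟨δ₂, hδ₂, hsub₂⟩ := mem_nhdsGT_iff_exists_Ioo_subset.1 hnear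
  have hδ₂' : (0 : ℝ) < δ₂ := hδ₂
  -- a disc containing the domain and the unit disc about `a`
  obtain ⟨r, hr⟩ := D.isBounded.subset_closedBall (0 : ℂ)
  set rΛ : ℝ := max r 0 + ‖D.pt 0‖ + 1 with hrΛ
  have hrΛ0 : 0 ≤ rΛ := by rw [hrΛ]; positivity
  have hΩ : D.carrier ⊆ closedBall (0 : ℂ) rΛ := hr.trans (closedBall_subset_closedBall (by
    rw [hrΛ]; linarith [le_max_left r 0, norm_nonneg (D.pt 0)]))
  have hball : ball (D.pt 0) 1 ⊆ closedBall (0 : ℂ) rΛ := by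
    intro z hz
    rw [mem_ball] at hz
    rw [mem_closedBall, dist_zero_right]
    have := norm_le_norm_add_norm_sub' z (D.pt 0)
    rw [← dist_eq_norm] at this
    rw [hrΛ]
    linarith [le_max_right r 0]
  -- the mesh threshold
  set δ₁ : ℝ := min (min δ₀ (δ₂ / 2)) 1 with hδ₁
  have hδ₁pos : 0 < δ₁ := lt_min (lt_min hδ₀ (half_pos hδ₂')) one_pos
  have hδ₁1 : δ₁ ≤ 1 := min_le_right _ _
  have hδ₁δ₀ : δ₁ ≤ δ₀ := (min_le_left _ _).trans (min_le_left _ _)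
  have hδ₁δ₂ : δ₁ < δ₂ := ((min_le_left _ _).trans (min_le_right _ _)).trans_lt (half_lt_self hδ₂')
  -- the criterion (SET form: this is its native output)
  have hmain := isTightMeasureSet_of_traversalBounds (E := ℂ) (isCompact_closedBall (0 : ℂ) rΛ)
    (C := 9 * (rΛ + 2) ^ 2) (d := 2) (by norm_num)
    (fun ρ hρ hρ1 ↦ exists_finset_card_le_cover_closedBall hrΛ0 ρ hρ hρ1)
    (Ω := fun δ ↦ HexDomainSAW D.carrier δ (a δ) (b δ))
    (fun δ ↦ hexSAWLaw D.carrier δ (a δ) (b δ))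
    (fun δ γ ↦ hexPolyline γ)
    (fun x ρ R ↦ max (2 * (242 + 1) + 1) (k x ρ R)) (K := K) (lam := lam)
    hK hlam (T := Set.Ioc 0 δ₁) (fun δ hδ ↦ ⟨hδ.1, hδ.2.trans hδ₁1⟩) ?_ ?_
  · exact ⟨δ₁, hδ₁pos, hmain⟩
  · -- (H0): range in `Λ`, and the short-distance cutoff
    intro δ hδ
    have hδpos : 0 < δ := hδ.1
    refine Eventually.of_forall fun γ ↦ ⟨?_, fun x ρ R _ hρδ hρR htr ↦ ?_⟩
    · change Set.range (γ.walk.toCurve fun v => (δ : ℂ) * hexCenter v) ⊆ closedBall 0 rΛ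
      refine range_toCurve_subset_of_convex γ.walk (convex_closedBall 0 rΛ) fun p hp ↦ ?_
      rcases γ.walk.mem_support_iff.1 hp with rfl | hp
      · exact hball (hsub₂ ⟨hδpos, hδ.2.trans_lt hδ₁δ₂⟩)
      · exact hΩ (embMeshDomain_subset _ _ _ _ (mem_embMeshDomain_of_mem_support_tail γ.walk hp))
    · exact not_hasTraversals_hexPolyline hδpos γ hρδ hρR (htr.of_le (le_max_left _ _))
  · -- (H1): the traversal bound, weakened in the threshold
    intro δ hδ x ρ R hδρ hρR hR1
    have hδ' : δ ∈ Set.Ioc 0 δ₀ := ⟨hδ.1, hδ.2.trans hδ₁δ₀⟩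
    exact le_trans (measure_mono fun γ hγ ↦ Curve.HasTraversals.of_le hγ (le_max_right _ _))
      (hbound δ hδ' x ρ R hδρ hρR hR1)

/-! ### Composition (PROVED): stubs ⇒ the crux, by name -/

/-- **The composition.** `stub_interiorThinPerShellTight → stub_onFrontierFarPerShellTight → HexEventualTight`
(route `SAWBetheAnsatz`, BY NAME): the two atoms give Aizenman–Burchard's (H1) per `(D, a, b)`
(`traversalBound_of_atoms`), and the AB criterion in set form (`isTightMeasureSet_image_of_traversalBound`)
gives a mesh threshold below which the push-forward laws are tight. -/
theorem HexEventualTight_of (h1 : __Registered.stub_interiorThinPerShellTight)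
    (h2 : __Registered.stub_onFrontierFarPerShellTight) :
    Summit.CriticalPhenomena.SAWScalingLimit.Theses.SAWBetheAnsatz.HexEventualTight := by
  intro D a b hab
  exact isTightMeasureSet_image_of_traversalBound hab (traversalBound_of_atoms h1 h2 D a b hab)

/-- Wiring check: the registered stubs feed `HexEventualTight_of` as stated (becomes the crux proof when the
two `sorry`s above are discharged). -/
example : Summit.CriticalPhenomena.SAWScalingLimit.Theses.SAWBetheAnsatz.HexEventualTight :=
  HexEventualTight_of stub_interiorThinPerShellTight stub_onFrontierFarPerShellTight

end Summit.CriticalPhenomena.SAWScalingLimit.Cruxes.HexEventualTight.Birth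

end
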